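import Mathlib
import HarnessLib

/-!
# Limit points of normalized prime gaps: the set `𝓛` and Merikoski's four-point theorem

The sequence of normalized prime gaps `(p_{n+1} − p_n)/log p_n` and the set `𝓛` of its (finite) limit
points. Erdős conjectured `𝓛 = [0, ∞]`; `𝓛` is closed; Banks–Freiberg–Maynard 2016 showed that among any
nine ordered reals some difference lies in `𝓛` [cite: BanksFreibergMaynard2016, Thm 1.1], Pintz improved
nine to five, and Merikoski 2020 to FOUR [cite: Merikoski2020GapLimitPoints, Theorem 1], whence
`μ(𝓛 ∩ [0,T]) ≥ T/3` for all `T > 0` [cite: Merikoski2020GapLimitPoints, Corollary 2] and `𝓛` is syndetic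
[cite: Merikoski2020GapLimitPoints, Corollary 3].

Contents: the definitions `normalizedPrimeGap`, `primeGapLimitSet` (with `isClosed_primeGapLimitSet`,
`measurableSet_primeGapLimitSet`), the `k`-point property `HasPointProperty B k` of a set of reals, its
monotonicity in `k`, and the named fact `Merikoski2020_theorem1` (Theorem 1 as printed; a deep sieve
theorem — Maynard–Tao sieve with a modification of Banks–Freiberg–Maynard's argument — vendored, not
proved). Requested by the Parity ideation cell (parity-ideate-p4 ROUND-3/4, family E «gap-set», where
`MerikoskiFourPoint := FourPoint gapLimitSet` is the printed input of the «Kneser amplifier» corollaries).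
-/

open Filter Set MeasureTheory

namespace Literature.NumberTheory.Sieve

/-- The `n`-th normalized prime gap `(p_{n+1} − p_n) / log p_n`, with `p_0 = 2, p_1 = 3, …` Mathlib's
`Nat.nth Nat.Prime` (the source indexes from `p_1 = 2`; the set of limit points is unaffected).
[cite: Merikoski2020GapLimitPoints, §1] -/
noncomputable def normalizedPrimeGap (n : ℕ) : ℝ :=
  ((Nat.nth Nat.Prime (n + 1) : ℝ) - (Nat.nth Nat.Prime n : ℝ)) / Real.log (Nat.nth Nat.Prime n)

/-- `𝓛`, the set of (finite) limit points of the sequence of normalized prime gaps: the reals `β` that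
are cluster points of `n ↦ (p_{n+1} − p_n)/log p_n` as `n → ∞` ("the set of limit points of the sequence
`{(p_{n+1} − p_n)/log p_n}`"; the source also allows the value `∞ ∈ 𝓛`, by Westzynthius, which is not a
real number and is omitted here). [cite: Merikoski2020GapLimitPoints, §1] -/
def primeGapLimitSet : Set ℝ := {β | MapClusterPt β atTop normalizedPrimeGap}

/-- Unfolding `primeGapLimitSet` ("the set of limit points of the sequence").
[cite: Merikoski2020GapLimitPoints, §1] -/
theorem mem_primeGapLimitSet {β : ℝ} :
    β ∈ primeGapLimitSet ↔ MapClusterPt β atTop normalizedPrimeGap := Iff.rfl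

/-- "`𝓛` is Lebesgue-measurable since it is a closed set." — `𝓛` is closed.
[cite: Merikoski2020GapLimitPoints, §1] -/
theorem isClosed_primeGapLimitSet : IsClosed primeGapLimitSet :=
  isClosed_setOf_clusterPt

/-- "`𝓛` is Lebesgue-measurable since it is a closed set." [cite: Merikoski2020GapLimitPoints, §1] -/
theorem measurableSet_primeGapLimitSet : MeasurableSet primeGapLimitSet :=
  isClosed_primeGapLimitSet.measurableSet

/-- The `k`-POINT PROPERTY of a set `B` of reals: among any `k` ordered reals `β_0 ≤ β_1 ≤ ⋯ ≤ β_{k-1}`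
some difference `β_j − β_i` (`i < j`) lies in `B` — the common shape of [cite: BanksFreibergMaynard2016, Thm 1.1]
(`k = 9`), Pintz (`k = 5`) and [cite: Merikoski2020GapLimitPoints, Theorem 1] (`k = 4`) for `B = 𝓛`. -/
def HasPointProperty (B : Set ℝ) (k : ℕ) : Prop :=
  ∀ β : Fin k → ℝ, Monotone β → ∃ i j : Fin k, i < j ∧ β j - β i ∈ B

/-- The `k`-point property implies the `l`-point property for `l ≥ k` (restrict to the first `k` points)
— the sense in which Theorem 1 (`k = 4`) supersedes Pintz (`k = 5`) and Banks–Freiberg–Maynard (`k = 9`),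
remark after Theorem 1 of the source. [cite: Merikoski2020GapLimitPoints, §1 (remark after Theorem 1)] -/
theorem HasPointProperty.mono {B : Set ℝ} {k l : ℕ} (h : HasPointProperty B k) (hkl : k ≤ l) :
    HasPointProperty B l := by
  intro β hβ
  obtain ⟨i, j, hij, hmem⟩ := h (fun i => β (Fin.castLE hkl i)) (fun a b hab => hβ (by simpa using hab))
  exact ⟨Fin.castLE hkl i, Fin.castLE hkl j, by simpa using hij, hmem⟩

/-- **Merikoski 2020, Theorem 1** (as printed): "Let `β₁ ≤ β₂ ≤ β₃ ≤ β₄` be any real numbers. Then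
`𝓛 ∩ {β_j − β_i : 1 ≤ i < j ≤ 4} ≠ ∅`." (`𝓛` = `primeGapLimitSet`; "[BFM] gives this for nine real numbers
in place of four, and [Pintz] is the same but for five real numbers".) A deep theorem (Maynard–Tao sieve,
modifying Banks–Freiberg–Maynard), vendored as a named fact; written with the six differences spelled out.
[cite: Merikoski2020GapLimitPoints, Theorem 1] -/
def Merikoski2020_theorem1 : Prop :=
  ∀ β₁ β₂ β₃ β₄ : ℝ, β₁ ≤ β₂ → β₂ ≤ β₃ → β₃ ≤ β₄ →
    (β₂ - β₁ ∈ primeGapLimitSet ∨ β₃ - β₁ ∈ primeGapLimitSet ∨ β₄ - β₁ ∈ primeGapLimitSet ∨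
      β₃ - β₂ ∈ primeGapLimitSet ∨ β₄ - β₂ ∈ primeGapLimitSet ∨ β₄ - β₃ ∈ primeGapLimitSet)

/-- Theorem 1 in the `k`-point-property currency: `𝓛` has the `4`-point property.
[cite: Merikoski2020GapLimitPoints, Theorem 1] -/
theorem Merikoski2020_theorem1.hasPointProperty_four (h : Merikoski2020_theorem1) :
    HasPointProperty primeGapLimitSet 4 := by
  intro β hβ
  have h01 : β 0 ≤ β 1 := hβ (by decide)
  have h12 : β 1 ≤ β 2 := hβ (by decide)
  have h23 : β 2 ≤ β 3 := hβ (by decide)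
  rcases h (β 0) (β 1) (β 2) (β 3) h01 h12 h23 with h | h | h | h | h | h
  · exact ⟨0, 1, by decide, h⟩
  · exact ⟨0, 2, by decide, h⟩
  · exact ⟨0, 3, by decide, h⟩
  · exact ⟨1, 2, by decide, h⟩
  · exact ⟨1, 3, by decide, h⟩
  · exact ⟨2, 3, by decide, h⟩

/-- Conversely the `4`-point property of `𝓛` gives back the printed six-difference form (the two
renderings of Theorem 1 are equivalent). [cite: Merikoski2020GapLimitPoints, Theorem 1] -/
theorem merikoski2020_theorem1_of_hasPointProperty_four (h : HasPointProperty primeGapLimitSet 4) :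
    Merikoski2020_theorem1 := by
  intro β₁ β₂ β₃ β₄ h12 h23 h34
  obtain ⟨i, j, hij, hmem⟩ := h ![β₁, β₂, β₃, β₄] (by
    refine Fin.monotone_iff_le_succ.2 fun i => ?_
    fin_cases i <;> simp [h12, h23, h34])
  fin_cases i <;> fin_cases j <;> simp at hij hmem ⊢ <;> tauto

/-- In particular, with `0 ∈ 𝓛` excluded from use: among any `0 ≤ β₁ ≤ β₂ ≤ β₃ ≤ β₄` some difference is
a (finite, non-negative) limit point of normalized prime gaps — the hypothesis shape `FourPoint 𝓛` of the
Parity cell's Sketch3. [cite: Merikoski2020GapLimitPoints, Theorem 1] -/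
theorem Merikoski2020_theorem1.fourPoint_nonneg (h : Merikoski2020_theorem1) :
    ∀ β₁ β₂ β₃ β₄ : ℝ, 0 ≤ β₁ → β₁ ≤ β₂ → β₂ ≤ β₃ → β₃ ≤ β₄ →
      (β₂ - β₁ ∈ primeGapLimitSet ∨ β₃ - β₁ ∈ primeGapLimitSet ∨ β₄ - β₁ ∈ primeGapLimitSet ∨
        β₃ - β₂ ∈ primeGapLimitSet ∨ β₄ - β₂ ∈ primeGapLimitSet ∨ β₄ - β₃ ∈ primeGapLimitSet) :=
  fun β₁ β₂ β₃ β₄ _ h12 h23 h34 => h β₁ β₂ β₃ β₄ h12 h23 h34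

end Literature.NumberTheory.Sieve
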